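import Summits.NavierStokesRegularity.NavierStokesRegularity.Theorems.EulerZoomLiouvillePowerGaugeEulerLiouvilleNeedleGradientGrowthTools
import Summits.NavierStokesRegularity.NavierStokesRegularity.Theorems.EulerZoomLiouvillePowerGaugeEulerLiouvilleNeedleThinCore
import Summits.NavierStokesRegularity.NavierStokesRegularity.Theorems.EulerZoomLiouvillePowerGaugeEulerLiouvilleSelfSimilarRadialBarrierLoc
import Summits.NavierStokesRegularity.NavierStokesRegularity.Theorems.EulerZoomLiouvillePowerGaugeEulerLiouvilleNeedleThinCoreMember
import HarnessLib

/-!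
# Crux E `PowerGaugeEulerLiouville` (stmt-NavierStokesRegularity-19832) — SCALE-OSCILLATION TAMENESS
# (the common roof of the «uniformly continuous» and the «sub-(2+ρ) gradient growth» tame strata)

Route №10 `EulerZoomLiouville` (NavierStokesRegularity), crux E, THE ONE STATEMENT `stub_selfSimilarC2Needle` (skeleton of
record `Cruxes/PowerGaugeEulerLiouville/Lines/birth.lean`; interim LEAD ns-typeII-p2 g10 → g11; third lane of ns-ezl-w1 g2,
announced 2026-08-28T10:0xZ).  The needle-thinness kernel (`NeedleThinness.needle_inradius_le_radial`, nsreg-p2 g31) kills a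
fast-inflow point `⟪y, V y⟫ < −κ‖y‖²` as soon as the radial component stays `≤ −κ‖y‖/2` on a ball `B(y, r)` whose radius is
not too small, `r ≳ ‖y‖^{1−q}` with `q < 2 + ρ` (file `…NeedleGradientGrowth`: there the ball came from a gradient bound and the
mean-value inequality).  The honest hypothesis is therefore an OSCILLATION BOUND AT A POLYNOMIAL SCALE:

  (Osc)  `‖V y' − V y‖ ≤ (κ/2)‖y‖` whenever `‖y' − y‖ ≤ K ‖y‖^{1−q}` and `‖y‖ ≥ R₀`, for some `K > 0`, `q < 2 + ρ`.

* `radialBarrier_of_oscTame` — PROFILE THEOREM: a `C¹` profile with the class A-growth, the op-norm E-weight and (Osc) has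
  `−κ‖y‖² ≤ ⟪y, V y⟫` for all large `‖y‖`;
* `selfSimilar_ae_eq_zero_of_oscTame` — MEMBER COROLLARY (crux binders verbatim + exact self-similarity + `C²` profile + (Osc) with
  `κ/2 = 1/(4(2+ρ))`): trivial, via `Loc.selfSimilar_ae_eq_zero_of_radialInflowC2_profile` with `κ = γ/2`;
* (file 2/2 `…NeedleOscillationTameInstances.lean`) `oscTame_of_uniformContinuous` — `UniformContinuous V` ⇒ (Osc) with `q = 1`
  (the UC disjunct of `IsTameC2Profile` is an instance); `oscTame_of_polyGradient` — `‖∇V(y)‖ ≤ K(1+‖y‖)^q` ⇒ (Osc) at scale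
  `‖y‖^{1−max q 0}` (the stratum of `…NeedleGradientGrowth` is an instance).

So ONE predicate, `∃ q K R₀, q < 2+ρ ∧ 0 < K ∧ ∀ y, R₀ ≤ ‖y‖ → ∀ y', ‖y' − y‖ ≤ K‖y‖^(1−q) → ‖V y' − V y‖ ≤ ‖y‖/(4(2+ρ))`, can replace
both the «uniformly continuous» and the «polynomial gradient» disjuncts of `IsTameC2Profile`; the registered needle must oscillate by
`≳ ‖y‖` across EVERY polynomially small scale `‖y‖^{1−q}`, `q < 2+ρ`, at its fast-inflow points.

WHAT THIS IS NOT: not NS, not E — a tame SUB-STRATUM of THE ONE STATEMENT; 19832 OPEN.  [folklore; length–area method via t36/t36d]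
-/

noncomputable section

set_option linter.dupNamespace false

open MeasureTheory Set Filter Topology Metric Function Real
open scoped RealInnerProductSpace ENNReal NNReal

namespace Summit.NavierStokesRegularity.NavierStokesRegularity.Theorems.PowerGaugeEulerLiouville.NeedleOscillationTame

open NeedleDiscChart NeedleThinness NeedleGradientGrowth Literature.Analysis Literature.Analysis.FluidPDE

/-! ## Real-variable bookkeeping for the scale `r ≥ K₁ s^{1−q₁}` -/

/-- Disc budget of the short cylinder at scale `r ≥ K₁ s^{1−q₁}`: `32𝓐/((κ/2)²(s−r/4)²(r/2))/π ≤ 7 s²` once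
`65536(3c+1) ≤ 1575 π κ² K₁ s` (`𝓐 = c(3s)^{1−2ρ}+1`, `1 ≤ q₁ ≤ 3`, `s ≥ 1`). [folklore] -/
theorem aux_budget_le {s r κ K₁ c q₁ ρ : ℝ} (hs1 : 1 ≤ s) (hκ : 0 < κ) (hK₁ : 0 < K₁) (hc : 0 ≤ c) (hρ : 0 ≤ ρ)
    (hq₁3 : q₁ ≤ 3) (hr0 : 0 < r) (hrs : r ≤ s / 4) (hrK : K₁ * s ^ (1 - q₁) ≤ r)
    (hsA : 65536 * (3 * c + 1) ≤ 1575 * π * κ ^ 2 * K₁ * s) :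
    32 * (c * (3 * s) ^ (1 - 2 * ρ) + 1) / ((κ / 2) ^ 2 * (s - r / 4) ^ 2 * (r / 2)) / π ≤ 7 * s ^ 2 := by
  have hs0 : 0 < s := by linarith
  have hs₀0 : 0 < s - r / 4 := by linarith
  have hden : 0 < (κ / 2) ^ 2 * (s - r / 4) ^ 2 * (r / 2) := by positivity
  rw [div_le_iff₀ Real.pi_pos, div_le_iff₀ hden]
  have h𝓐 : c * (3 * s) ^ (1 - 2 * ρ) + 1 ≤ (3 * c + 1) * s := by
    have h1 : (3 * s) ^ (1 - 2 * ρ) ≤ (3 * s) ^ (1 : ℝ) :=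
      Real.rpow_le_rpow_of_exponent_le (by linarith) (by linarith)
    rw [Real.rpow_one] at h1
    have h2 : c * (3 * s) ^ (1 - 2 * ρ) ≤ c * (3 * s) := mul_le_mul_of_nonneg_left h1 hc
    linarith only [h2, hs1]
  have hs₀2 : 225 / 256 * s ^ 2 ≤ (s - r / 4) ^ 2 := by
    have h := pow_le_pow_left₀ (by positivity) (by linarith : 15 / 16 * s ≤ s - r / 4) 2
    have e : (15 / 16 * s) ^ 2 = 225 / 256 * s ^ 2 := by ring
    rwa [e] at h
  -- `s ≤ s³ · s^{1−q₁}`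
  have hpow : s ≤ s ^ 3 * s ^ (1 - q₁) := by
    have hs3 : s ^ (3 : ℝ) = s ^ 3 := by exact_mod_cast Real.rpow_natCast s 3
    have h : s ^ (1 : ℝ) ≤ s ^ (4 - q₁) := Real.rpow_le_rpow_of_exponent_le hs1 (by linarith)
    rw [Real.rpow_one] at h
    have e : s ^ (4 - q₁) = s ^ 3 * s ^ (1 - q₁) := by
      rw [← hs3, ← Real.rpow_add hs0]
      congr 1
      ring
    rwa [e] at h
  -- `65536 (3c+1) s ≤ 1575 π κ² K₁ s⁴ s^{1−q₁} ≤ 1575 π κ² s⁴ r`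
  have k1 : 65536 * (3 * c + 1) * s ≤ 1575 * π * κ ^ 2 * s ^ 4 * r := by
    have hP : 0 ≤ 1575 * π * κ ^ 2 * K₁ := by positivity
    calc 65536 * (3 * c + 1) * s ≤ (1575 * π * κ ^ 2 * K₁ * s) * s := mul_le_mul_of_nonneg_right hsA hs0.le
      _ ≤ (1575 * π * κ ^ 2 * K₁ * (s ^ 3 * s ^ (1 - q₁))) * s :=
          mul_le_mul_of_nonneg_right (mul_le_mul_of_nonneg_left hpow hP) hs0.le
      _ = 1575 * π * κ ^ 2 * s ^ 4 * (K₁ * s ^ (1 - q₁)) := by ring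
      _ ≤ 1575 * π * κ ^ 2 * s ^ 4 * r := mul_le_mul_of_nonneg_left hrK (by positivity)
  have k2 : 1575 / 2048 * s ^ 2 ≤ 7 / 8 * (s - r / 4) ^ 2 := by linarith only [hs₀2, sq_nonneg s]
  calc 32 * (c * (3 * s) ^ (1 - 2 * ρ) + 1) ≤ 32 * ((3 * c + 1) * s) := by linarith only [h𝓐]
    _ ≤ 1575 / 2048 * π * κ ^ 2 * s ^ 4 * r := by linarith only [k1]
    _ = (π * κ ^ 2 * s ^ 2 * r) * (1575 / 2048 * s ^ 2) := by ring
    _ ≤ (π * κ ^ 2 * s ^ 2 * r) * (7 / 8 * (s - r / 4) ^ 2) := mul_le_mul_of_nonneg_left k2 (by positivity)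
    _ = 7 * s ^ 2 * π * ((κ / 2) ^ 2 * (s - r / 4) ^ 2 * (r / 2)) := by ring

/-- The kernel's exponent at scale `r ≥ K₁ s^{1−q₁}` dominates `B₁ s^{2+ρ−q₁}`, `B₁ = π κ² K₁/(1024 C₁)`. [folklore] -/
theorem aux_exponent_ge {s r κ K₁ C₁ q₁ ρ : ℝ} (hs1 : 1 ≤ s) (hκ : 0 < κ) (hK₁ : 0 < K₁) (hC₁ : 0 < C₁) (hρ : 0 ≤ ρ)
    (hr0 : 0 < r) (hrs : r ≤ s / 4) (hrK : K₁ * s ^ (1 - q₁) ≤ r) :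
    π * κ ^ 2 * K₁ / (1024 * C₁) * s ^ (2 + ρ - q₁) ≤
      π * (κ / 2 * (s - r / 4)) ^ 2 * (r / 2) / (16 * ((3 * s) ^ (1 - ρ) * C₁)) := by
  have hs0 : 0 < s := by linarith
  have hC₁ne : C₁ ≠ 0 := hC₁.ne'
  have h3s : 0 < (3 * s) ^ (1 - ρ) := Real.rpow_pos_of_pos (by positivity) _
  rw [le_div_iff₀ (by positivity)]
  have h1 : (3 * s) ^ (1 - ρ) ≤ 3 * s ^ (1 - ρ) := by
    rw [Real.mul_rpow (by norm_num) hs0.le]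
    have : (3 : ℝ) ^ (1 - ρ) ≤ (3 : ℝ) ^ (1 : ℝ) := Real.rpow_le_rpow_of_exponent_le (by norm_num) (by linarith)
    rw [Real.rpow_one] at this
    exact mul_le_mul_of_nonneg_right this (by positivity)
  have h3 : s ^ (2 + ρ - q₁) * s ^ (1 - ρ) = s ^ 2 * s ^ (1 - q₁) := by
    have hs2 : s ^ (2 : ℝ) = s ^ 2 := by exact_mod_cast Real.rpow_natCast s 2
    rw [← Real.rpow_add hs0, ← hs2, ← Real.rpow_add hs0]
    congr 1
    ring
  have hsθ : 0 < s ^ (2 + ρ - q₁) := Real.rpow_pos_of_pos hs0 _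
  have h4 : K₁ * (s ^ (2 + ρ - q₁) * s ^ (1 - ρ)) ≤ s ^ 2 * r := by
    rw [h3]
    calc K₁ * (s ^ 2 * s ^ (1 - q₁)) = s ^ 2 * (K₁ * s ^ (1 - q₁)) := by ring
      _ ≤ s ^ 2 * r := mul_le_mul_of_nonneg_left hrK (by positivity)
  have hs₀2 : (15 / 16 * s) ^ 2 ≤ (s - r / 4) ^ 2 := pow_le_pow_left₀ (by positivity) (by linarith) 2
  have l1 : π * κ ^ 2 * K₁ / (1024 * C₁) * s ^ (2 + ρ - q₁) * (16 * ((3 * s) ^ (1 - ρ) * C₁)) =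
      π * κ ^ 2 / 64 * (K₁ * (s ^ (2 + ρ - q₁) * (3 * s) ^ (1 - ρ))) := by
    field_simp
    ring
  calc π * κ ^ 2 * K₁ / (1024 * C₁) * s ^ (2 + ρ - q₁) * (16 * ((3 * s) ^ (1 - ρ) * C₁))
      = π * κ ^ 2 / 64 * (K₁ * (s ^ (2 + ρ - q₁) * (3 * s) ^ (1 - ρ))) := l1
    _ ≤ π * κ ^ 2 / 64 * (K₁ * (s ^ (2 + ρ - q₁) * (3 * s ^ (1 - ρ)))) :=
        mul_le_mul_of_nonneg_left (mul_le_mul_of_nonneg_left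
          (mul_le_mul_of_nonneg_left h1 hsθ.le) hK₁.le) (by positivity)
    _ = 3 * π * κ ^ 2 / 64 * (K₁ * (s ^ (2 + ρ - q₁) * s ^ (1 - ρ))) := by ring
    _ ≤ 3 * π * κ ^ 2 / 64 * (s ^ 2 * r) := mul_le_mul_of_nonneg_left h4 (by positivity)
    _ = 3 / 64 * (π * κ ^ 2 * s ^ 2 * r) := by ring
    _ ≤ 225 / 2048 * (π * κ ^ 2 * s ^ 2 * r) := mul_le_mul_of_nonneg_right (by norm_num) (by positivity)
    _ = π * κ ^ 2 / 8 * (15 / 16 * s) ^ 2 * r := by ring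
    _ ≤ π * κ ^ 2 / 8 * (s - r / 4) ^ 2 * r :=
        mul_le_mul_of_nonneg_right (mul_le_mul_of_nonneg_left hs₀2 (by positivity)) hr0.le
    _ = π * (κ / 2 * (s - r / 4)) ^ 2 * (r / 2) := by ring

/-- The final contradiction at scale `r ≥ K₁ s^{1−q₁}`: `r/2 ≤ 3 s E` and `6 s^{q₁} E < K₁` are incompatible. [folklore] -/
theorem aux_contra {s r K₁ q₁ E : ℝ} (hs0 : 0 < s) (hrK : K₁ * s ^ (1 - q₁) ≤ r) (hw3 : r / 2 ≤ 3 * s * E)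
    (hev : 6 * (s ^ q₁ * E) < K₁) : False := by
  have hsq : 0 < s ^ (1 - q₁) := Real.rpow_pos_of_pos hs0 _
  have hsplit : s = s ^ q₁ * s ^ (1 - q₁) := by
    rw [← Real.rpow_add hs0]
    norm_num
  have h1 : K₁ * s ^ (1 - q₁) ≤ (6 * (s ^ q₁ * E)) * s ^ (1 - q₁) := by
    calc K₁ * s ^ (1 - q₁) ≤ r := hrK
      _ ≤ 6 * s * E := by linarith only [hw3]
      _ = (6 * (s ^ q₁ * E)) * s ^ (1 - q₁) := by
          conv_lhs => rw [hsplit]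
          ring
  have h2 : K₁ ≤ 6 * (s ^ q₁ * E) := le_of_mul_le_mul_right h1 hsq
  linarith only [h2, hev]

/-! ## The profile theorem -/

/-- **SCALE-OSCILLATION TAMENESS (profile level).**  Let `V : ℝ³ → ℝ³` be `C¹` with the A-growth `∫⁻_{B_L} ‖V‖ₑ² ≤ c L^{1−2ρ}`
(`L > 0`), the op-norm E-weight `∫⁻ ‖∇V(y)‖ₑ² ‖y‖^{ρ−1} dy ≤ C`, `0 < ρ < 1`, and the OSCILLATION BOUND AT A POLYNOMIAL SCALE
`‖V y' − V y‖ ≤ (κ/2)‖y‖` whenever `‖y' − y‖ ≤ K‖y‖^{1−q}`, `‖y‖ ≥ R₀` (`K > 0`, `q < 2 + ρ`).  Then `−κ‖y‖² ≤ ⟪y, V y⟫` for all large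
`‖y‖`.  Proof: at a fast point `y`, `‖y‖ = s`, the oscillation bound keeps `−⟪ŷ, V⟫ ≥ κ s/2` on `B(y, r)`, `r = K₁ s^{1−q₁}`
(`q₁ = max q 1`, `K₁ = min K (1/4)`), and the needle-thinness kernel on the coaxial cylinder of height and radius `r/2` inside that
ball gives `r/2 ≤ 3 s·exp(−B₁ s^{2+ρ−q₁})`, impossible for large `s`. [folklore; length–area method, t36/t36d] -/
theorem radialBarrier_of_oscTame {ρ : ℝ} (hρ : 0 < ρ) (hρ1 : ρ < 1) {c : ℝ≥0} {C : ℝ}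
    {V : EuclideanSpace ℝ (Fin 3) → EuclideanSpace ℝ (Fin 3)} (hV : ContDiff ℝ 1 V)
    (hA : ∀ L : ℝ, 0 < L → ∫⁻ y in ball (0 : EuclideanSpace ℝ (Fin 3)) L, ‖V y‖ₑ ^ 2 ≤
      (c : ℝ≥0∞) * ENNReal.ofReal (L ^ (1 - 2 * ρ)))
    (hE : ∫⁻ y, ‖fderiv ℝ V y‖ₑ ^ 2 * ENNReal.ofReal (‖y‖ ^ (ρ - 1)) ≤ ENNReal.ofReal C)
    {κ q K R₀ : ℝ} (hκ : 0 < κ) (hq : q < 2 + ρ) (hK : 0 < K)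
    (hosc : ∀ y : EuclideanSpace ℝ (Fin 3), R₀ ≤ ‖y‖ → ∀ y' : EuclideanSpace ℝ (Fin 3),
      ‖y' - y‖ ≤ K * ‖y‖ ^ (1 - q) → ‖V y' - V y‖ ≤ κ / 2 * ‖y‖) :
    ∃ R₁ : ℝ, ∀ y : EuclideanSpace ℝ (Fin 3), R₁ ≤ ‖y‖ → -(κ * ‖y‖ ^ 2) ≤ ⟪y, V y⟫ := by
  -- constants
  obtain ⟨q₁, hq₁⟩ : ∃ q₁ : ℝ, q₁ = max q 1 := ⟨_, rfl⟩
  have hqq₁ : q ≤ q₁ := by rw [hq₁]; exact le_max_left _ _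
  have hq₁1 : 1 ≤ q₁ := by rw [hq₁]; exact le_max_right _ _
  have hq₁3 : q₁ ≤ 3 := by rw [hq₁]; exact max_le (by linarith) (by norm_num)
  have hθ0 : 0 < 2 + ρ - q₁ := by rw [hq₁]; have := max_lt hq (by linarith : (1 : ℝ) < 2 + ρ); linarith
  obtain ⟨K₁, hK₁⟩ : ∃ K₁ : ℝ, K₁ = min K (1 / 4) := ⟨_, rfl⟩
  have hK₁0 : 0 < K₁ := by rw [hK₁]; exact lt_min hK (by norm_num)
  have hK₁K : K₁ ≤ K := by rw [hK₁]; exact min_le_left _ _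
  have hK₁4 : K₁ ≤ 1 / 4 := by rw [hK₁]; exact min_le_right _ _
  obtain ⟨C₁, hC₁⟩ : ∃ C₁ : ℝ, C₁ = max C 0 + 1 := ⟨_, rfl⟩
  have hC₁0 : 0 < C₁ := by rw [hC₁]; positivity
  have hCC₁ : C ≤ C₁ := by rw [hC₁]; exact (le_max_left C 0).trans (le_add_of_nonneg_right zero_le_one)
  obtain ⟨B₁, hB₁⟩ : ∃ B₁ : ℝ, B₁ = π * κ ^ 2 * K₁ / (1024 * C₁) := ⟨_, rfl⟩
  have hB₁0 : 0 < B₁ := by rw [hB₁]; positivity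
  obtain ⟨A₂, hA₂⟩ : ∃ A₂ : ℝ, A₂ = 65536 * (3 * (c : ℝ) + 1) / (1575 * π * κ ^ 2 * K₁) := ⟨_, rfl⟩
  -- the eventual inequality «exponential beats power»
  have hev : ∀ᶠ s : ℝ in atTop, 6 * (s ^ q₁ * Real.exp (-(B₁ * s ^ (2 + ρ - q₁)))) < K₁ := by
    have ht := (tendsto_rpow_mul_exp_neg_rpow (a := q₁) hB₁0 hθ0).const_mul 6
    rw [mul_zero] at ht
    exact ht.eventually (Iio_mem_nhds hK₁0)
  obtain ⟨R₂, hR₂⟩ := eventually_atTop.1 hev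
  refine ⟨max (max 1 A₂) (max R₀ R₂), fun y hy => ?_⟩
  -- a fast point `y`, `‖y‖ = s`
  by_contra hlt0
  have hlt1 := lt_of_not_ge hlt0
  obtain ⟨s, hs⟩ : ∃ s : ℝ, s = ‖y‖ := ⟨_, rfl⟩
  rw [← hs] at hy hlt1
  have hs1 : 1 ≤ s := ((le_max_left _ _).trans (le_max_left _ _)).trans hy
  have hsA₂ : A₂ ≤ s := ((le_max_right _ _).trans (le_max_left _ _)).trans hy
  have hsR₀ : R₀ ≤ s := ((le_max_left _ _).trans (le_max_right _ _)).trans hy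
  have hev_s := hR₂ s (((le_max_right _ _).trans (le_max_right _ _)).trans hy)
  have hs0 : 0 < s := by linarith
  have hsne : s ≠ 0 := hs0.ne'
  have hsA : 65536 * (3 * (c : ℝ) + 1) ≤ 1575 * π * κ ^ 2 * K₁ * s := by
    rw [hA₂, div_le_iff₀ (by positivity)] at hsA₂
    linarith only [hsA₂]
  -- the unit vector and the frame
  obtain ⟨e, he_def⟩ : ∃ e : EuclideanSpace ℝ (Fin 3), e = s⁻¹ • y := ⟨_, rfl⟩
  have he : ‖e‖ = 1 := by
    rw [he_def, norm_smul, norm_inv, Real.norm_eq_abs, abs_of_pos hs0, ← hs, inv_mul_cancel₀ hsne]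
  have hye : y = s • e := by rw [he_def, smul_smul, mul_inv_cancel₀ hsne, one_smul]
  have hfast : ⟪e, V y⟫ < -(κ * s) := by
    have h1 : ⟪y, V y⟫ = s * ⟪e, V y⟫ := by rw [← real_inner_smul_left, ← hye]
    have h2 : s * ⟪e, V y⟫ < s * (-(κ * s)) := by
      have e1 : s * (-(κ * s)) = -(κ * s ^ 2) := by ring
      rw [← h1, e1]
      exact hlt1
    exact lt_of_mul_lt_mul_left h2 hs0.le
  obtain ⟨e₁, e₂, hon⟩ := exists_orthonormal_frame he
  -- the scale `r = K₁ s^{1−q₁}`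
  obtain ⟨r, hr_def⟩ : ∃ r : ℝ, r = K₁ * s ^ (1 - q₁) := ⟨_, rfl⟩
  have hr0 : 0 < r := by rw [hr_def]; exact mul_pos hK₁0 (Real.rpow_pos_of_pos hs0 _)
  have hrK₁ : K₁ * s ^ (1 - q₁) ≤ r := hr_def.ge
  have hrK : r ≤ K * s ^ (1 - q) := by
    rw [hr_def]
    have h1 : s ^ (1 - q₁) ≤ s ^ (1 - q) := Real.rpow_le_rpow_of_exponent_le hs1 (by linarith)
    exact mul_le_mul hK₁K h1 (Real.rpow_pos_of_pos hs0 _).le hK.le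
  have hrs : r ≤ s / 4 := by
    rw [hr_def]
    have h1 : s ^ (1 - q₁) ≤ s ^ (0 : ℝ) := Real.rpow_le_rpow_of_exponent_le hs1 (by linarith)
    rw [Real.rpow_zero] at h1
    have h2 : K₁ * s ^ (1 - q₁) ≤ 1 / 4 * 1 := mul_le_mul hK₁4 h1 (Real.rpow_pos_of_pos hs0 _).le (by norm_num)
    linarith only [h2, hs1]
  -- the core on the ball `B(y, r)` from the oscillation bound
  have hball : ∀ y' ∈ ball y r, κ * s / 2 ≤ -⟪e, V y'⟫ := by
    intro y' hy'
    rw [mem_ball, dist_eq_norm] at hy'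
    have hos : ‖V y' - V y‖ ≤ κ / 2 * s := by
      have h := hosc y (by rw [← hs]; exact hsR₀) y' (by rw [← hs]; exact hy'.le.trans hrK)
      rwa [← hs] at h
    have hinner : ⟪e, V y'⟫ - ⟪e, V y⟫ ≤ ‖V y' - V y‖ := by
      rw [← inner_sub_right]
      exact (real_inner_le_norm _ _).trans (by rw [he, one_mul])
    linarith only [hos, hinner, hfast]
  -- kernel data
  have hs₀0 : 0 < s - r / 4 := by linarith
  have hh0 : 0 < r / 2 := by positivity
  have hκk0 : 0 < κ / 2 := by positivity
  have h3s : 0 < 3 * s := by positivity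
  have h𝓔0 : 0 < (3 * s) ^ (1 - ρ) * C₁ := by positivity
  have h𝓐0 : 0 < (c : ℝ) * (3 * s) ^ (1 - 2 * ρ) + 1 := by positivity
  obtain ⟨D, hD_def⟩ : ∃ D : ℝ,
      D = 32 * ((c : ℝ) * (3 * s) ^ (1 - 2 * ρ) + 1) / ((κ / 2) ^ 2 * (s - r / 4) ^ 2 * (r / 2)) / π :=
    ⟨_, rfl⟩
  have hD0 : 0 < D := by rw [hD_def]; positivity
  obtain ⟨δ, hδ_def⟩ : ∃ δ : ℝ, δ = Real.sqrt ((r / 2) ^ 2 + D) := ⟨_, rfl⟩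
  have hδsq : δ ^ 2 = (r / 2) ^ 2 + D := by rw [hδ_def]; exact Real.sq_sqrt (by positivity)
  have hδ0 : 0 ≤ δ := by rw [hδ_def]; exact Real.sqrt_nonneg _
  have hwδ : r / 2 < δ := by
    rw [hδ_def, Real.lt_sqrt hh0.le]
    linarith only [hD0]
  have hbudget : 32 * ((c : ℝ) * (3 * s) ^ (1 - 2 * ρ) + 1) / ((κ / 2) ^ 2 * (s - r / 4) ^ 2 * (r / 2)) ≤
      π * (δ ^ 2 - (r / 2) ^ 2) := by
    rw [hδsq, add_sub_cancel_left, hD_def, mul_div_cancel₀ _ Real.pi_pos.ne']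
  -- the ball budgets at radius `R = 3s`
  have hEball : ∫⁻ y in ball (0 : EuclideanSpace ℝ (Fin 3)) (3 * s), ‖fderiv ℝ V y‖ₑ ^ 2 ≤
      ENNReal.ofReal ((3 * s) ^ (1 - ρ) * C₁) := by
    refine (NeedleThinCore.lintegral_ball_fderiv_sq_le_of_opWeight hρ1 hE h3s).trans ?_
    rw [← ENNReal.ofReal_mul (by positivity)]
    exact ENNReal.ofReal_le_ofReal (mul_le_mul_of_nonneg_left hCC₁ (by positivity))
  have hAball : ∫⁻ y in ball (0 : EuclideanSpace ℝ (Fin 3)) (3 * s), ‖V y‖ₑ ^ 2 ≤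
      ENNReal.ofReal ((c : ℝ) * (3 * s) ^ (1 - 2 * ρ) + 1) := by
    refine (hA (3 * s) h3s).trans ?_
    rw [← ENNReal.ofReal_coe_nnreal, ← ENNReal.ofReal_mul (NNReal.coe_nonneg c)]
    exact ENNReal.ofReal_le_ofReal (le_add_of_nonneg_right zero_le_one)
  -- the cylinder and its disc fit in `B(0, 3s)`
  have hD7 : D ≤ 7 * s ^ 2 := by
    rw [hD_def]
    exact aux_budget_le hs1 hκ hK₁0 (NNReal.coe_nonneg c) hρ.le hq₁3 hr0 hrs hrK₁ hsA
  have hR : (s - r / 4 + r / 2) ^ 2 + δ ^ 2 ≤ (3 * s) ^ 2 := aux_fit hs0.le hr0.le hrs hD7 hδsq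
  -- the core hypothesis on the short cylinder
  have hcore : ∀ t ∈ Ioo (s - r / 4) (s - r / 4 + r / 2), ∀ z : ℂ, ‖z‖ ≤ r / 2 →
      κ / 2 * (s - r / 4) ≤ -⟪e, V (discChart (t • e) e₁ e₂ z)⟫ := by
    intro t ht z hz
    have hmem : discChart (t • e) e₁ e₂ z ∈ ball (s • e) r := discChart_mem_ball_of_short hon hr0 ht hz
    rw [← hye] at hmem
    have hin := hball _ hmem
    have : κ * (s - r / 4) ≤ κ * s := mul_le_mul_of_nonneg_left (by linarith) hκ.le
    linarith only [hin, this]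
  -- THE KERNEL
  have hVd : Differentiable ℝ V := hV.differentiable one_ne_zero
  have hker := needle_inradius_le_radial (V' := fderiv ℝ V) (fun y => (hVd y).hasFDerivAt)
    (hV.continuous_fderiv one_ne_zero) hon hs₀0 hh0 hh0 hwδ hκk0 h3s hR h𝓔0 h𝓐0 hEball hAball hbudget hcore
  -- the exponent dominates `B₁ s^{2+ρ−q₁}`
  have hX : B₁ * s ^ (2 + ρ - q₁) ≤
      π * (κ / 2 * (s - r / 4)) ^ 2 * (r / 2) / (16 * ((3 * s) ^ (1 - ρ) * C₁)) := by
    rw [hB₁]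
    exact aux_exponent_ge hs1 hκ hK₁0 hC₁0 hρ.le hr0 hrs hrK₁
  -- `r/2 ≤ δ e^{−X} ≤ 3 s e^{−B₁ s^θ}`
  have hδ3 : δ ≤ 3 * s := by
    have : δ ^ 2 ≤ (3 * s) ^ 2 := by linarith only [hR, sq_nonneg (s - r / 4 + r / 2)]
    exact (pow_le_pow_iff_left₀ hδ0 (by positivity) two_ne_zero).1 this
  have hw3 : r / 2 ≤ 3 * s * Real.exp (-(B₁ * s ^ (2 + ρ - q₁))) := by
    calc r / 2 ≤ δ * Real.exp (-(π * (κ / 2 * (s - r / 4)) ^ 2 * (r / 2) / (16 * ((3 * s) ^ (1 - ρ) * C₁)))) :=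
          hker
      _ ≤ δ * Real.exp (-(B₁ * s ^ (2 + ρ - q₁))) :=
          mul_le_mul_of_nonneg_left (Real.exp_le_exp.2 (neg_le_neg hX)) hδ0
      _ ≤ 3 * s * Real.exp (-(B₁ * s ^ (2 + ρ - q₁))) := mul_le_mul_of_nonneg_right hδ3 (Real.exp_pos _).le
  exact aux_contra hs0 hrK₁ hw3 hev_s

/-! ## The member corollary -/

/-- **SCALE-OSCILLATION TAMENESS (member level).**  Under the crux hypotheses verbatim (suitable weak Euler solution on `ℝ³ × (−∞,0)`
with weak spatial gradient `H` and the three power gauges `a^{2ρ}A + a^ρ E + a^{2ρ}D ≤ c`), exact self-similarity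
`u(τ) = (−τ)^{γ−1} V((−τ)^{−γ} ·)`, `p(τ) = (−τ)^{2γ−2} P((−τ)^{−γ} ·)`, `γ = 1/(2+ρ)`, in the window `0 < ρ ≤ 1/2`, a `C²` profile
whose oscillation at the polynomial scale `K‖y‖^{1−q}` (`K > 0`, `q < 2+ρ`) is at most `‖y‖/(4(2+ρ))` far out, the member is trivial:
`radialBarrier_of_oscTame` with `κ = γ/2` (inputs `NeedleThinCore.selfSimilar_needle_inputs`) and
`Loc.selfSimilar_ae_eq_zero_of_radialInflowC2_profile`.  Subsumes the «uniformly continuous» disjunct of `IsTameC2Profile`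
(`oscTame_of_uniformContinuous`) and the polynomial-gradient stratum (`oscTame_of_polyGradient`). [folklore] -/
theorem selfSimilar_ae_eq_zero_of_oscTame {ρ : ℝ} (hρ : 0 < ρ) (hρh : ρ ≤ 1 / 2)
    {u : ℝ → EuclideanSpace ℝ (Fin 3) → EuclideanSpace ℝ (Fin 3)} {p : ℝ → EuclideanSpace ℝ (Fin 3) → ℝ}
    {H : ℝ → EuclideanSpace ℝ (Fin 3) → EuclideanSpace ℝ (Fin 3) →L[ℝ] EuclideanSpace ℝ (Fin 3)} {c : ℝ≥0}
    (hsw : IsSuitableWeakSolutionOn (slab (EuclideanSpace ℝ (Fin 3)) (Iio 0) isOpen_Iio) 0 0 u p)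
    (hH : HasWeakSpatialGradientOn (slab (EuclideanSpace ℝ (Fin 3)) (Iio 0) isOpen_Iio) u H)
    (hgauge : ∀ a : ℝ, 0 < a →
      ENNReal.ofReal (a ^ (2 * ρ)) * cknA a (0 : ℝ × EuclideanSpace ℝ (Fin 3)) u +
          ENNReal.ofReal (a ^ ρ) * cknE a (0 : ℝ × EuclideanSpace ℝ (Fin 3)) H +
        ENNReal.ofReal (a ^ (2 * ρ)) * cknD a (0 : ℝ × EuclideanSpace ℝ (Fin 3)) p ≤ (c : ℝ≥0∞))
    {V : EuclideanSpace ℝ (Fin 3) → EuclideanSpace ℝ (Fin 3)} {P : EuclideanSpace ℝ (Fin 3) → ℝ}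
    (hu : ∀ τ : ℝ, τ < 0 → u τ = selfSimilarCollapse (1 / (2 + ρ)) 0 V τ)
    (hp : ∀ τ : ℝ, τ < 0 → p τ = selfSimilarCollapsePressure (1 / (2 + ρ)) 0 P τ)
    (hV : ContDiff ℝ 2 V) {q K R₀ : ℝ} (hq : q < 2 + ρ) (hK : 0 < K)
    (hosc : ∀ y : EuclideanSpace ℝ (Fin 3), R₀ ≤ ‖y‖ → ∀ y' : EuclideanSpace ℝ (Fin 3),
      ‖y' - y‖ ≤ K * ‖y‖ ^ (1 - q) → ‖V y' - V y‖ ≤ ‖y‖ / (4 * (2 + ρ))) :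
    uncurry u =ᵐ[volume.restrict (Iio (0 : ℝ) ×ˢ (univ : Set (EuclideanSpace ℝ (Fin 3))))] 0 := by
  have hρ1 : ρ < 1 := by linarith
  have hV1 : ContDiff ℝ 1 V := hV.of_le one_le_two
  obtain ⟨hA, hE⟩ := NeedleThinCore.selfSimilar_needle_inputs hρ hρ1 hsw hH hgauge hu hp hV1
  have h2ρ : (0 : ℝ) < 2 + ρ := by linarith
  have hγ : (0 : ℝ) < 1 / (2 + ρ) := one_div_pos.2 h2ρ
  have hosc' : ∀ y : EuclideanSpace ℝ (Fin 3), R₀ ≤ ‖y‖ → ∀ y' : EuclideanSpace ℝ (Fin 3),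
      ‖y' - y‖ ≤ K * ‖y‖ ^ (1 - q) → ‖V y' - V y‖ ≤ 1 / (2 + ρ) / 2 / 2 * ‖y‖ := by
    intro y hy y' hy'
    have h := hosc y hy y' hy'
    have e : ‖y‖ / (4 * (2 + ρ)) = 1 / (2 + ρ) / 2 / 2 * ‖y‖ := by
      field_simp
      ring
    rwa [e] at h
  obtain ⟨R₁, hR₁⟩ := radialBarrier_of_oscTame hρ hρ1 hV1 hA hE (half_pos hγ) hq hK hosc'
  exact Loc.selfSimilar_ae_eq_zero_of_radialInflowC2_profile hρ hρh hsw hgauge hu hp hV (half_lt_self hγ) hR₁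

end Summit.NavierStokesRegularity.NavierStokesRegularity.Theorems.PowerGaugeEulerLiouville.NeedleOscillationTame

end
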